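import Literature.MathematicalPhysics.QuantumManyBody.BoseEinsteinCondensation
import Mathlib.Analysis.SpecialFunctions.Trigonometric.Basic
import Mathlib.Analysis.SpecialFunctions.Log.Basic
import Mathlib.Analysis.SpecialFunctions.Pow.Real

/-!
# Crux `BoundaryTransferWeak` (stmt-AtomisticToContinuum-0827), line `Sketch`
# (idea `coupled-bath-relocation`): the `v = 0` SHAPE of the coupled relocation bound

Calibration of the line's research stub `CoupledRelocationBound` (v2) at the free gas, at the level
of the two slice SHAPES (idea card, "Cheapest falsifier (1)"; `CoupledRelocationBoundFreeShape`):
the Dirichlet ground state of the free Bose gas in the box `(0,L)³` is the product of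
`u(x) = ∏_α (2/L)^{1/2} sin(Real.pi x_α / L)`, so every box slice is a positive multiple of `u`, while the
constant torus state has constant slices.  Both pairwise bounds of the v2 good event then hold with
EMPTY exceptional sets and the cost bound `M₀ = (3/2) log 2` (`e^{M₀} = 2^{3/2}`), for every pair of
baths and hence under ANY coupling: for `x` in the inner cube `C = (L/4, 3L/4)³` and any `y` in the
closed box, `∏_α sin(Real.pi y_α/L) ≤ 2^{3/2} ∏_α sin(Real.pi x_α/L)` — two-sidedly on `C` (swap `x`, `y`) and
one-directionally from `C` outwards.  (The tagged-particle membership clause of the v1 typing is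
what fails at `v = 0`; the shape bounds do not — `Lines/Sketch.md`.)
-/

noncomputable section

namespace Summit.AtomisticToContinuum.BoseEinsteinCondensation.CoupledBaths

open Literature.MathematicalPhysics.QuantumManyBody.BoseGas

/-- On the inner third... precisely: for `s ∈ (L/4, 3L/4)` one has `sin(Real.pi s / L) ≥ sin(Real.pi/4) = √2/2`.
[folklore] -/
private theorem sqrt_two_div_two_le_sin {L s : ℝ} (hL : 0 < L) (hs : s ∈ Set.Ioo (1 / 4 * L) (L - 1 / 4 * L)) :
    Real.sqrt 2 / 2 ≤ Real.sin (Real.pi * s / L) := by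
  obtain ⟨h1, h2⟩ := hs
  have hθ1 : Real.pi / 4 < Real.pi * s / L := by
    rw [lt_div_iff₀ hL]; nlinarith [Real.pi_pos]
  have hθ2 : Real.pi * s / L < 3 * Real.pi / 4 := by
    rw [div_lt_iff₀ hL]; nlinarith [Real.pi_pos]
  rw [← Real.sin_pi_div_four]
  rcases le_or_gt (Real.pi * s / L) (Real.pi / 2) with h | h
  · exact Real.sin_le_sin_of_le_of_le_pi_div_two (by linarith [Real.pi_pos]) h hθ1.le
  · -- reflect: sin θ = sin (Real.pi - θ), and Real.pi/4 < Real.pi - θ < Real.pi/2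
    rw [← Real.sin_pi_sub (Real.pi * s / L)]
    exact Real.sin_le_sin_of_le_of_le_pi_div_two (by linarith [Real.pi_pos]) (by linarith)
      (by linarith)

/-- For `s ∈ [0, L]`, `0 ≤ sin(Real.pi s / L) ≤ 1`. [folklore] -/
private theorem sin_nonneg_of_mem_Icc {L s : ℝ} (hL : 0 < L) (hs : s ∈ Set.Icc 0 L) :
    0 ≤ Real.sin (Real.pi * s / L) := by
  obtain ⟨h1, h2⟩ := hs
  refine Real.sin_nonneg_of_nonneg_of_le_pi (by positivity) ?_
  rw [div_le_iff₀ hL]; nlinarith [Real.pi_pos]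

/-- **The `v = 0` shape of the coupled relocation bound.** For `L > 0`, `x` in the inner cube
`(L/4, 3L/4)³` and `y` in the closed box `[0, L]³`:
`∏_α sin(Real.pi y_α / L) ≤ e^{(3/2) log 2} ∏_α sin(Real.pi x_α / L)`.  Consequently, for the free Dirichlet
ground-state slice `ψ = k ∏_α sin(Real.pi ·_α/L)` (`k > 0`) and a constant torus slice `φ`, both pairwise
bounds of the line's v2 good event hold with `S = T = ∅` and `M₀ = (3/2) log 2`:
`ψ(x)φ(y) ≤ e^{M₀} ψ(y)φ(x)` for `x, y` in the cube and `ψ(y)φ(x) ≤ e^{M₀} ψ(x)φ(y)` for `x` in the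
cube and `y` anywhere in the box. [folklore] -/
theorem prod_sin_le_exp_mul_prod_sin :
    ∀ (L : ℝ), 0 < L → ∀ (x y : Space),
      x ∈ {x : Space | ∀ t, x t ∈ Set.Ioo (1 / 4 * L) (L - 1 / 4 * L)} →
      (∀ t, y t ∈ Set.Icc 0 L) →
        ∏ t : Fin 3, Real.sin (Real.pi * y t / L) ≤
          Real.exp (3 / 2 * Real.log 2) * ∏ t : Fin 3, Real.sin (Real.pi * x t / L) := by
  intro L hL x y hx hy
  -- `e^{(3/2) log 2} = (√2)³` and `(√2)³ ∏ sin(Real.pi x_t/L) = ∏ (√2 sin(Real.pi x_t/L)) ≥ ∏ 1 ≥ ∏ sin(Real.pi y_t/L)`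
  have hexp : Real.exp (3 / 2 * Real.log 2) = Real.sqrt 2 ^ 3 := by
    rw [mul_comm, Real.exp_mul, Real.exp_log (by norm_num : (0:ℝ) < 2), Real.sqrt_eq_rpow,
      ← Real.rpow_natCast, ← Real.rpow_mul (by norm_num : (0:ℝ) ≤ 2)]
    norm_num
  rw [hexp]
  have hprod : Real.sqrt 2 ^ 3 * ∏ t : Fin 3, Real.sin (Real.pi * x t / L) =
      ∏ t : Fin 3, (Real.sqrt 2 * Real.sin (Real.pi * x t / L)) := by
    rw [Finset.prod_mul_distrib, Finset.prod_const, Finset.card_univ, Fintype.card_fin]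
  rw [hprod]
  calc ∏ t : Fin 3, Real.sin (Real.pi * y t / L)
      ≤ ∏ _t : Fin 3, (1 : ℝ) :=
        Finset.prod_le_prod (fun t _ => sin_nonneg_of_mem_Icc hL (hy t))
          fun t _ => Real.sin_le_one _
    _ ≤ ∏ t : Fin 3, (Real.sqrt 2 * Real.sin (Real.pi * x t / L)) := by
        refine Finset.prod_le_prod (fun _ _ => zero_le_one) fun t _ => ?_
        have h := sqrt_two_div_two_le_sin hL (hx t)
        have h2 : Real.sqrt 2 * (Real.sqrt 2 / 2) = 1 := by
          rw [← mul_div_assoc, Real.mul_self_sqrt (by norm_num : (0:ℝ) ≤ 2)]; norm_num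
        calc (1 : ℝ) = Real.sqrt 2 * (Real.sqrt 2 / 2) := h2.symm
          _ ≤ Real.sqrt 2 * Real.sin (Real.pi * x t / L) :=
            mul_le_mul_of_nonneg_left h (Real.sqrt_nonneg _)

end Summit.AtomisticToContinuum.BoseEinsteinCondensation.CoupledBaths

end
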